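import Summits.Parity.BatemanHorn.Theorems.RoughValueTransportBalancedSemiprimeLayerQuadraticSieveDefs
import HarnessLib

/-!
# Quadratic sieve for the balanced-semiprime layer, 2/7: the pair sequence and the splittings

The line `smooth-modulus-twisted-hooley` of crux `BalancedSemiprimeLayer` (route
`RoughValueTransport`, item stmt-Parity-9469) bounds the relaxed sifted divisor family
`pairFamily f i δ c x` of a QUADRATIC coordinate `g = fᵢ = aX² + bX + c` of a Bateman–Horn system
`f` (window `m ∈ (x^{1−δ}, x^{1+δ}]`, `m ∣ g(n)`, `(m, B) = 1`, `B = |2a·disc g|`, every `fⱼ(n)`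
free of primes `< x^c`) by ONE `(k+1)`-dimensional upper-bound sieve: the pairs `(n, m)` are
booked at the value `F(n) = ∏ⱼ fⱼ(n)` and sifted by the primes `< z = x^c` (the tree's PROVED
Fundamental Lemma `SieveSequence.fundamental_lemma_explicit`); the main term comes from the window
sums of `ρ_g(m)/m` (the tree's PROVED `RhoLogSums.abs_rhoLogSum_sub_le`), the remainders ARE the
uniform Type-I information `UniformTypeI g` on dyadic blocks of `n`.  The proof is spread over
seven files `RoughValueTransportBalancedSemiprimeLayerQuadraticSieve<Part>.lean`, `<Part>` =
`Defs`, `Sequence`, `Remainder`, `Core`, `Bookkeeping`, `Height`, and the empty suffix (the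
registered stub `stub_quadraticSieve`).

This file: the Mertens-type comparison `∏_{p≤y}(1 − g(p)) ≤ Q₀e⁶·∏_{p≤y}(1 − ρ_G(p)/p)`
(termwise, `ρ_G(p) ≤ 2` off `Q₀`), the dictionary of the pair sequence (`congrSum_pairSeq`,
`sifted_pairSeq`: its congruence sums and sifting function COUNT pairs), and the three splittings
of `A_d`: by `e = (m, d)` (`sum_card_eq_sum_divisors`), into dyadic blocks
(`card_filter_Ioc_eq_sum_range`) and into root classes (`card_filter_dvd_and_dvd_eq_sum`).
-/

noncomputable section

open Polynomial Filter Finset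
open Literature.NumberTheory.Sieve
open scoped ArithmeticFunction.Moebius NumberTheorySymbols

namespace Summit.Parity.BatemanHorn.Cruxes.BalancedSemiprimeLayer.SmoothModulusTwistedHooley

namespace QuadraticSieve

open Iwaniec1978 RhoLogSums PropertySTypeI

variable {a b c : ℤ}

/-! ### C. Mertens-type upper bound for `∏_{p ≤ y} (1 − g(p))` -/

/-- Termwise: `1 − g(p) ≤ w(p) · (1 − ρ_G(p)/p)` with `w(p) = p` at the primes of `Q₀` and
`w(p) = 1 + 6/p²` at the others (there `ρ_G(p) ≤ 2 < 3 ≤ p` and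
`1 − g(p) = (p−1)/(p−1+ρ)`), provided `ρ_G(p) < p`. [folklore] -/
theorem one_sub_rhoDensity_le (ha : 0 < a) (hB : badB a b c ≠ 0) {p : ℕ} (hp : p.Prime)
    (hρp : rhoG a b c p < p) :
    1 - rhoDensity a b c (badQ a b c) p ≤
      (if p ∣ badQ a b c then (p : ℝ) else 1 + 6 / (p : ℝ) ^ 2) *
        (1 - (rhoG a b c p : ℝ) / p) := by
  have hp0 : (0 : ℝ) < p := by exact_mod_cast hp.pos
  rw [rhoDensity_prime a b c _ hp]
  by_cases hpQ : p ∣ badQ a b c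
  · rw [if_pos hpQ, if_pos hpQ, sub_zero]
    have h1 : (rhoG a b c p : ℝ) + 1 ≤ p := by exact_mod_cast Nat.succ_le_of_lt hρp
    have : (p : ℝ) * (1 - (rhoG a b c p : ℝ) / p) = p - rhoG a b c p := by
      field_simp
    rw [this]; linarith
  · rw [if_neg hpQ, if_neg hpQ]
    have hp2 : p ≠ 2 := fun h => hpQ (h ▸ two_dvd_badQ hB)
    have hp3 : (3 : ℝ) ≤ p := by exact_mod_cast Nat.succ_le_of_lt (lt_of_le_of_ne hp.two_le (Ne.symm hp2))
    have hρ2 := rhoG_le_two_of_not_dvd_badQ ha hB hp hpQ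
    set ρ : ℕ := rhoG a b c p with hρdef
    have hden : 0 < (p : ℝ) - 1 + ρ := by
      have : (0 : ℝ) ≤ ρ := Nat.cast_nonneg _
      linarith
    have hlhs : 1 - (ρ : ℝ) / ((p : ℝ) - 1 + ρ) = ((p : ℝ) - 1) / ((p : ℝ) - 1 + ρ) := by
      field_simp; ring
    rw [hlhs, div_le_iff₀ hden]
    interval_cases ρ
    · simp only [Nat.cast_zero, zero_div, sub_zero, add_zero, mul_one]
      have : 0 ≤ 6 / (p : ℝ) ^ 2 := by positivity
      nlinarith
    · simp only [Nat.cast_one]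
      have h6 : 0 ≤ 6 / (p : ℝ) ^ 2 := by positivity
      have e : (1 + 6 / (p : ℝ) ^ 2) * (1 - 1 / (p : ℝ)) * ((p : ℝ) - 1 + 1) =
          ((p : ℝ) - 1) * (1 + 6 / (p : ℝ) ^ 2) := by field_simp; ring
      rw [e]; nlinarith
    · simp only [Nat.cast_ofNat]
      have e : (1 + 6 / (p : ℝ) ^ 2) * (1 - 2 / (p : ℝ)) * ((p : ℝ) - 1 + 2) =
          ((p : ℝ) ^ 2 + 6) * ((p : ℝ) - 2) * ((p : ℝ) + 1) / (p : ℝ) ^ 3 := by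
        field_simp; ring
      rw [e, le_div_iff₀ (by positivity)]
      nlinarith [sq_nonneg ((p : ℝ) - 3)]

/-- `∑_{p ≤ y} 1/p² ≤ 1` over the primes. [folklore] -/
theorem sum_primesLE_inv_sq_le_one (y : ℕ) : ∑ p ∈ Nat.primesLE y, 1 / (p : ℝ) ^ 2 ≤ 1 := by
  have hsub : Nat.primesLE y ⊆ Finset.Ioc 1 y := fun p hp => by
    rw [Nat.mem_primesLE] at hp
    rw [Finset.mem_Ioc]; exact ⟨hp.2.one_lt, hp.1⟩
  calc ∑ p ∈ Nat.primesLE y, 1 / (p : ℝ) ^ 2 ≤ ∑ n ∈ Finset.Ioc 1 y, 1 / (n : ℝ) ^ 2 :=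
        Finset.sum_le_sum_of_subset_of_nonneg hsub fun _ _ _ => by positivity
    _ ≤ 1 / ((1 : ℕ) : ℝ) := sum_Ioc_inv_sq_le le_rfl y
    _ = 1 := by norm_num

/-- **`∏_{p ≤ y} (1 − g(p)) ≤ Q₀ e^6 · ∏_{p ≤ y} (1 − ρ_G(p)/p)`** (from the termwise bound:
the bad primes `≤ y` multiply to at most `Q₀`, and `∏ (1 + 6/p²) ≤ e^{6 ∑ 1/p²} ≤ e^6`),
provided `ρ_G(p) < p` for every prime. [folklore] -/
theorem prod_one_sub_rhoDensity_le (ha : 0 < a) (hB : badB a b c ≠ 0)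
    (hρ : ∀ p : ℕ, p.Prime → rhoG a b c p < p) (y : ℕ) :
    ∏ p ∈ Nat.primesLE y, (1 - rhoDensity a b c (badQ a b c) p) ≤
      (badQ a b c : ℝ) * Real.exp 6 * ∏ p ∈ Nat.primesLE y, (1 - (rhoG a b c p : ℝ) / p) := by
  set S := Nat.primesLE y with hS
  have hprime : ∀ p ∈ S, p.Prime := fun p hp => Nat.prime_of_mem_primesLE hp
  set w : ℕ → ℝ := fun p => if p ∣ badQ a b c then (p : ℝ) else 1 + 6 / (p : ℝ) ^ 2 with hw
  have hstep : ∏ p ∈ S, (1 - rhoDensity a b c (badQ a b c) p) ≤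
      ∏ p ∈ S, (w p * (1 - (rhoG a b c p : ℝ) / p)) :=
    Finset.prod_le_prod (fun p hp => by
        linarith [(rhoDensity_prime_nonneg_lt_one a b c (badQ a b c) (hprime p hp)).2])
      fun p hp => one_sub_rhoDensity_le ha hB (hprime p hp) (hρ p (hprime p hp))
  rw [Finset.prod_mul_distrib] at hstep
  have hρnn : 0 ≤ ∏ p ∈ S, (1 - (rhoG a b c p : ℝ) / p) := Finset.prod_nonneg fun p hp => by
    have hp0 : (0 : ℝ) < p := by exact_mod_cast (hprime p hp).pos
    have : (rhoG a b c p : ℝ) ≤ p := by exact_mod_cast (hρ p (hprime p hp)).le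
    rw [sub_nonneg, div_le_one hp0]; exact this
  -- the weights
  have hw1 : ∏ p ∈ S, w p = (∏ p ∈ S.filter (· ∣ badQ a b c), (p : ℝ)) *
      ∏ p ∈ S.filter (fun p => ¬ p ∣ badQ a b c), (1 + 6 / (p : ℝ) ^ 2) := by
    simp only [hw]
    exact Finset.prod_ite (s := S) (p := fun p => p ∣ badQ a b c) (f := fun p => (p : ℝ))
      (g := fun p => 1 + 6 / (p : ℝ) ^ 2)
  have hbad : ∏ p ∈ S.filter (· ∣ badQ a b c), (p : ℝ) ≤ badQ a b c := by
    have hsub : S.filter (· ∣ badQ a b c) ⊆ (badB a b c).primeFactors := fun p hp => by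
      rw [Finset.mem_filter] at hp
      exact Nat.mem_primeFactors.mpr
        ⟨hprime p hp.1, (prime_dvd_badQ_iff hB (hprime p hp.1)).mp hp.2, hB⟩
    have h := Finset.prod_le_prod_of_subset_of_one_le (f := fun p : ℕ => (p : ℝ)) hsub
      (fun p _ => Nat.cast_nonneg p)
      (fun p hp _ => by exact_mod_cast (Nat.prime_of_mem_primeFactors hp).one_lt.le)
    refine h.trans (le_of_eq ?_)
    rw [badQ]; push_cast; rfl
  have hgood : ∏ p ∈ S.filter (fun p => ¬ p ∣ badQ a b c), (1 + 6 / (p : ℝ) ^ 2) ≤ Real.exp 6 := by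
    calc ∏ p ∈ S.filter (fun p => ¬ p ∣ badQ a b c), (1 + 6 / (p : ℝ) ^ 2)
        ≤ ∏ p ∈ S, (1 + 6 / (p : ℝ) ^ 2) :=
          Finset.prod_le_prod_of_subset_of_one_le (Finset.filter_subset _ _)
            (fun p _ => by positivity)
            (fun p _ _ => by
              have : 0 ≤ 6 / (p : ℝ) ^ 2 := by positivity
              linarith)
      _ ≤ ∏ p ∈ S, Real.exp (6 / (p : ℝ) ^ 2) :=
          Finset.prod_le_prod (fun p _ => by positivity) fun p _ => by
            have := Real.add_one_le_exp (6 / (p : ℝ) ^ 2); linarith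
      _ = Real.exp (6 * ∑ p ∈ S, 1 / (p : ℝ) ^ 2) := by
          rw [← Real.exp_sum, Finset.mul_sum]
          congr 1
          exact Finset.sum_congr rfl fun p _ => by ring
      _ ≤ Real.exp 6 := Real.exp_le_exp.mpr (by
          have := sum_primesLE_inv_sq_le_one y
          nlinarith)
  have hwle : ∏ p ∈ S, w p ≤ (badQ a b c : ℝ) * Real.exp 6 := by
    rw [hw1]
    exact mul_le_mul hbad hgood (Finset.prod_nonneg fun p _ => by positivity) (Nat.cast_nonneg _)
  calc ∏ p ∈ S, (1 - rhoDensity a b c (badQ a b c) p)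
      ≤ (∏ p ∈ S, w p) * ∏ p ∈ S, (1 - (rhoG a b c p : ℝ) / p) := hstep
    _ ≤ (badQ a b c : ℝ) * Real.exp 6 * ∏ p ∈ S, (1 - (rhoG a b c p : ℝ) / p) :=
        mul_le_mul_of_nonneg_right hwle hρnn

/-! ### D. The pair sequence: weights on the values `F(n)`, summed over the divisors `m` -/

/-- **Counting through the values** (adapted from `sum_filter_polyAPSeq_a_eq_card`): if
`0 < F(n) ≤ x` on `S`, then for any property `Q` of the value,
`∑_{1 ≤ v ≤ x, Q(v)} #{n ∈ S : F(n) = v} = #{n ∈ S : Q(|F(n)|)}`. [folklore] -/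
theorem sum_filter_card_eq_card (F : ℤ[X]) (S : Finset ℕ) {x : ℝ}
    (hx : ∀ n ∈ S, 0 < F.eval (n : ℤ) ∧ ((F.eval (n : ℤ) : ℤ) : ℝ) ≤ x)
    (Q : ℕ → Prop) [DecidablePred Q] :
    ∑ v ∈ (Ioc 0 ⌊x⌋₊).filter Q, (#(S.filter fun n : ℕ => F.eval (n : ℤ) = (v : ℤ)) : ℝ) =
      #(S.filter fun n : ℕ => Q (F.eval (n : ℤ)).natAbs) := by
  have hfib : ∀ v : ℕ, S.filter (fun n : ℕ => F.eval (n : ℤ) = (v : ℤ)) =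
      S.filter (fun n : ℕ => (F.eval (n : ℤ)).natAbs = v) := by
    intro v
    refine Finset.filter_congr fun n hn => ?_
    have h0 := (hx n hn).1
    constructor
    · intro h; rw [h, Int.natAbs_natCast]
    · intro h; rw [← h, Int.natAbs_of_nonneg h0.le]
  simp_rw [hfib]
  rw [← Nat.cast_sum, Finset.sum_card_fiberwise_eq_card_filter]
  congr 2
  ext n
  simp only [Finset.mem_filter, Finset.mem_Ioc, and_congr_right_iff]
  intro hn
  obtain ⟨h0, hle⟩ := hx n hn
  have hv0 : 0 < (F.eval (n : ℤ)).natAbs := Int.natAbs_pos.mpr h0.ne'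
  have hvx : (F.eval (n : ℤ)).natAbs ≤ ⌊x⌋₊ := by
    refine Nat.le_floor ?_
    have : (((F.eval (n : ℤ)).natAbs : ℤ) : ℝ) = ((F.eval (n : ℤ) : ℤ) : ℝ) := by
      rw [Int.natAbs_of_nonneg h0.le]
    rw [← Int.cast_natCast, this]
    exact hle
  exact ⟨fun h => h.2, fun h => ⟨⟨hv0, hvx⟩, h⟩⟩
/-- **The congruence sums of the pair sequence count pairs**:
`A_d(x) = ∑_{m ∈ M} #{n ∈ R : m ∣ G(n), d ∣ F(n)}` once `0 < F(n) ≤ x` on `R`. [folklore] -/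
theorem congrSum_pairSeq (G F : ℤ[X]) (R M : Finset ℕ) (X : ℝ) (g : ArithmeticFunction ℝ)
    (hg : g.IsMultiplicative) {x : ℝ}
    (hx : ∀ n ∈ R, 0 < F.eval (n : ℤ) ∧ ((F.eval (n : ℤ) : ℤ) : ℝ) ≤ x) (d : ℕ) :
    (pairSeq G F R M X g hg).congrSum d x =
      ∑ m ∈ M, (#(R.filter fun n : ℕ => (m : ℤ) ∣ G.eval (n : ℤ) ∧ (d : ℤ) ∣ F.eval (n : ℤ)) : ℝ) := by
  rw [SieveSequence.congrSum]
  change ∑ v ∈ (Ioc 0 ⌊x⌋₊).filter (d ∣ ·), ∑ m ∈ M,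
    (#(R.filter fun n : ℕ => (m : ℤ) ∣ G.eval (n : ℤ) ∧ F.eval (n : ℤ) = (v : ℤ)) : ℝ) = _
  rw [Finset.sum_comm]
  refine Finset.sum_congr rfl fun m _ => ?_
  have hx' : ∀ n ∈ R.filter (fun n : ℕ => (m : ℤ) ∣ G.eval (n : ℤ)),
      0 < F.eval (n : ℤ) ∧ ((F.eval (n : ℤ) : ℤ) : ℝ) ≤ x := fun n hn => hx n (mem_filter.mp hn).1
  have h := sum_filter_card_eq_card F (R.filter fun n : ℕ => (m : ℤ) ∣ G.eval (n : ℤ)) hx' (d ∣ ·)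
  simp only [Finset.filter_filter] at h
  rw [h]
  congr 2
  exact Finset.filter_congr fun n _ => and_congr_right fun _ => Int.natCast_dvd.symm

/-- **The sifting function of the pair sequence counts pairs**:
`S(𝒜, P; x) = ∑_{m ∈ M} #{n ∈ R : m ∣ G(n), (F(n), P) = 1}` once `0 < F(n) ≤ x` on `R`. [folklore] -/
theorem sifted_pairSeq (G F : ℤ[X]) (R M : Finset ℕ) (X : ℝ) (g : ArithmeticFunction ℝ)
    (hg : g.IsMultiplicative) {x : ℝ}
    (hx : ∀ n ∈ R, 0 < F.eval (n : ℤ) ∧ ((F.eval (n : ℤ) : ℤ) : ℝ) ≤ x) (P : ℕ) :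
    (pairSeq G F R M X g hg).sifted x P =
      ∑ m ∈ M, (#(R.filter fun n : ℕ =>
        (m : ℤ) ∣ G.eval (n : ℤ) ∧ (F.eval (n : ℤ)).natAbs.Coprime P) : ℝ) := by
  rw [SieveSequence.sifted]
  change ∑ v ∈ (Ioc 0 ⌊x⌋₊).filter (fun v : ℕ => v.Coprime P), ∑ m ∈ M,
    (#(R.filter fun n : ℕ => (m : ℤ) ∣ G.eval (n : ℤ) ∧ F.eval (n : ℤ) = (v : ℤ)) : ℝ) = _
  rw [Finset.sum_comm]
  refine Finset.sum_congr rfl fun m _ => ?_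
  have hx' : ∀ n ∈ R.filter (fun n : ℕ => (m : ℤ) ∣ G.eval (n : ℤ)),
      0 < F.eval (n : ℤ) ∧ ((F.eval (n : ℤ) : ℤ) : ℝ) ≤ x := fun n hn => hx n (mem_filter.mp hn).1
  have h := sum_filter_card_eq_card F (R.filter fun n : ℕ => (m : ℤ) ∣ G.eval (n : ℤ)) hx'
    (fun v : ℕ => v.Coprime P)
  simp only [Finset.filter_filter] at h
  rw [h]

/-! ### E. Splitting `A_d`: `e = (m, d)`, dyadic blocks, root classes -/

/-- For `d` squarefree and `e ∣ d`: `e` and `d/e` are coprime. [folklore] -/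
theorem coprime_div_of_squarefree {d e : ℕ} (hd : Squarefree d) (he : e ∣ d) : e.Coprime (d / e) := by
  refine Nat.coprime_of_dvd fun p hp hpe hpq => ?_
  have h2 : p * p ∣ d := by
    rw [← Nat.mul_div_cancel' he]
    exact mul_dvd_mul hpe hpq
  exact hp.one_lt.ne' (Nat.isUnit_iff.mp (hd p h2))

/-- **The `gcd`-splitting of the moduli**: for `d` squarefree and `e ∣ d`,
`(m, B) = 1 ∧ (m, d) = e  ↔  e ∣ m ∧ (m, (d/e)·B) = 1`. [folklore] -/
theorem coprime_and_gcd_eq_iff {d e : ℕ} (hd : Squarefree d) (he : e ∣ d) (m B : ℕ) :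
    (m.Coprime B ∧ Nat.gcd m d = e) ↔ (e ∣ m ∧ m.Coprime (d / e * B)) := by
  constructor
  · rintro ⟨hB, hg⟩
    have hem : e ∣ m := hg ▸ Nat.gcd_dvd_left m d
    refine ⟨hem, Nat.Coprime.mul_right ?_ hB⟩
    refine Nat.coprime_of_dvd fun p hp hpm hpq => ?_
    have hpd : p ∣ d := hpq.trans (Nat.div_dvd_of_dvd he)
    have hpe : p ∣ e := hg ▸ Nat.dvd_gcd hpm hpd
    have h2 : p * p ∣ d := by
      rw [← Nat.mul_div_cancel' he]
      exact mul_dvd_mul hpe hpq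
    exact hp.one_lt.ne' (Nat.isUnit_iff.mp (hd p h2))
  · rintro ⟨hem, hcop⟩
    refine ⟨Nat.Coprime.coprime_mul_left_right hcop, ?_⟩
    have hq : m.Coprime (d / e) := Nat.Coprime.coprime_mul_right_right hcop
    conv_lhs => rw [← Nat.mul_div_cancel' he]
    rw [Nat.Coprime.gcd_mul _ (coprime_div_of_squarefree hd he), Nat.gcd_eq_right hem,
      Nat.coprime_iff_gcd_eq_one.mp hq, mul_one]

/-- **Splitting `A_d` by `e = (m, d)`.**  If `G ∣ F` and `d` is squarefree, then
`∑_{U<m≤V, (m,B)=1} #{n ∈ R : m ∣ G(n), d ∣ F(n)} =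
 ∑_{e ∣ d} ∑_{U<m≤V, e ∣ m, (m,(d/e)B)=1} #{n ∈ R : m ∣ G(n), (d/e) ∣ F(n)}`
(the primes of `e` divide `m ∣ G(n) ∣ F(n)` for free). [folklore] -/
theorem sum_card_eq_sum_divisors {G F : ℤ[X]} (hGF : G ∣ F) {d : ℕ} (hd : Squarefree d)
    (R : Finset ℕ) (U V B : ℕ) :
    ∑ m ∈ (Ioc U V).filter (fun m : ℕ => m.Coprime B),
        (#(R.filter fun n : ℕ => (m : ℤ) ∣ G.eval (n : ℤ) ∧ (d : ℤ) ∣ F.eval (n : ℤ)) : ℝ) =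
      ∑ e ∈ d.divisors, ∑ m ∈ (Ioc U V).filter (fun m : ℕ => e ∣ m ∧ m.Coprime (d / e * B)),
        (#(R.filter fun n : ℕ =>
          (m : ℤ) ∣ G.eval (n : ℤ) ∧ ((d / e : ℕ) : ℤ) ∣ F.eval (n : ℤ)) : ℝ) := by
  rw [← Finset.sum_fiberwise_of_maps_to (g := fun m : ℕ => Nat.gcd m d) (t := d.divisors)
    (fun m _ => Nat.mem_divisors.mpr ⟨Nat.gcd_dvd_right m d, hd.ne_zero⟩)]
  refine Finset.sum_congr rfl fun e he => ?_
  have hed : e ∣ d := Nat.dvd_of_mem_divisors he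
  have hset : ((Ioc U V).filter (fun m : ℕ => m.Coprime B)).filter (fun m : ℕ => Nat.gcd m d = e) =
      (Ioc U V).filter (fun m : ℕ => e ∣ m ∧ m.Coprime (d / e * B)) := by
    rw [Finset.filter_filter]
    exact Finset.filter_congr fun m _ => coprime_and_gcd_eq_iff hd hed m B
  rw [hset]
  refine Finset.sum_congr rfl fun m hm => ?_
  obtain ⟨-, hem, -⟩ := Finset.mem_filter.mp hm
  have hcopZ : IsCoprime (e : ℤ) ((d / e : ℕ) : ℤ) :=
    Nat.isCoprime_iff_coprime.mpr (coprime_div_of_squarefree hd hed)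
  have hde : (e : ℤ) * ((d / e : ℕ) : ℤ) = (d : ℤ) := by exact_mod_cast Nat.mul_div_cancel' hed
  congr 2
  refine Finset.filter_congr fun n _ => and_congr_right fun hmG => ?_
  constructor
  · intro h
    exact dvd_trans (Int.natCast_dvd_natCast.mpr (Nat.div_dvd_of_dvd hed)) h
  · intro h
    have heF : (e : ℤ) ∣ F.eval (n : ℤ) :=
      dvd_trans (Int.natCast_dvd_natCast.mpr hem) (hmG.trans (Polynomial.eval_dvd hGF))
    rw [← hde]
    exact hcopZ.mul_dvd heF h

/-- **Dyadic blocks**: `(Y, 2^J Y] = ⨆_{j<J} (2^jY, 2^{j+1}Y]`, so a count over `(Y, 2^J Y]` is the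
sum of the counts over the blocks. [folklore] -/
theorem card_filter_Ioc_eq_sum_range (Y J : ℕ) (P : ℕ → Prop) [DecidablePred P] :
    #((Ioc Y (2 ^ J * Y)).filter P) =
      ∑ j ∈ range J, #((Ioc (2 ^ j * Y) (2 * (2 ^ j * Y))).filter P) := by
  induction J with
  | zero => simp
  | succ J ih =>
      rw [Finset.sum_range_succ, ← ih]
      have h1 : Y ≤ 2 ^ J * Y := Nat.le_mul_of_pos_left Y (Nat.pos_of_ne_zero (by positivity))
      have h2 : 2 ^ J * Y ≤ 2 * (2 ^ J * Y) := by omega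
      have hsplit : Ioc Y (2 ^ (J + 1) * Y) = Ioc Y (2 ^ J * Y) ∪ Ioc (2 ^ J * Y) (2 * (2 ^ J * Y)) := by
        rw [pow_succ, mul_comm (2 ^ J) 2, mul_assoc]
        exact (Finset.Ioc_union_Ioc_eq_Ioc h1 h2).symm
      rw [hsplit, Finset.filter_union, Finset.card_union_of_disjoint]
      refine Finset.disjoint_left.mpr fun n hn hn' => ?_
      rw [Finset.mem_filter, Finset.mem_Ioc] at hn hn'
      omega

/-- **Root classes**: for `q ≥ 1`,
`#{t ∈ S : m ∣ G(t), q ∣ F(t)} = ∑_{r mod q, q ∣ F(r)} #{t ∈ S : t ≡ r (q), m ∣ G(t)}`. [folklore] -/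
theorem card_filter_dvd_and_dvd_eq_sum (G F : ℤ[X]) (S : Finset ℕ) (m : ℕ) {q : ℕ} (hq : 0 < q) :
    #(S.filter fun t : ℕ => (m : ℤ) ∣ G.eval (t : ℤ) ∧ (q : ℤ) ∣ F.eval (t : ℤ)) =
      ∑ r ∈ (range q).filter (fun r : ℕ => (q : ℤ) ∣ F.eval (r : ℤ)),
        #(S.filter fun t : ℕ => t % q = r % q ∧ (m : ℤ) ∣ G.eval (t : ℤ)) := by
  have h := card_filter_dvd_eval_eq_sum F (S.filter fun t : ℕ => (m : ℤ) ∣ G.eval (t : ℤ)) hq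
  rw [Finset.filter_filter] at h
  rw [h]
  refine Finset.sum_congr rfl fun r _ => ?_
  rw [Finset.filter_filter]
  congr 1
  exact Finset.filter_congr fun t _ => and_comm

end QuadraticSieve

/-- **Anchor of part 2/7**: the registered sub-goal `stub_quadraticSieve_part2` of
`stub_quadraticSieve` (`ledger workitem stub-add`), through which this helper file lands
`--supports stmt-Parity-9469`:
the `gcd`-splitting of the moduli behind `sum_card_eq_sum_divisors`. [folklore] -/
theorem stub_quadraticSieve_part2 :
    ∀ (d e m B : ℕ), Squarefree d → e ∣ d → ((m.Coprime B ∧ Nat.gcd m d = e) ↔ (e ∣ m ∧ m.Coprime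
      (d / e * B))) :=
  fun _ _ m B hd he => QuadraticSieve.coprime_and_gcd_eq_iff hd he m B

end Summit.Parity.BatemanHorn.Cruxes.BalancedSemiprimeLayer.SmoothModulusTwistedHooley
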